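import Mathlib

/-!
# Lemma 5.8(b) at `k = 3` for three residual levels (the `n = 4` step of the vertex recursion)

Kernel anchor for `pub-imbrie/b2b-imbrie-2/DENSITY-XY.md` §5.4 (ADDENDUM C), Lemma 5.8(b) in the
case used by the four-level target T4: for three levels `ν₁, ν₂, ν₃` all at distance `≥ G` from
the removed level `z` (so `c_j := (ν_j - z)² ≥ G²`) and nonnegative weights `v`,
`D₃(v) = v₁v₂v₃Δ(ν)² ≤ (16/G²) · m̃ · D̃₂`, where `m̃ = Σ c_j v_j` and
`D̃₂ = Σ_{i<j} (c_i v_i)(c_j v_j)(ν_i - ν_j)²`. Proof as in the note: remove the level closest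
to `z` (`j'`), bound `(ν_i - ν_{j'})² ≤ 2c_i + 2c_{j'} ≤ 4c_i` (inlined), and `v_{j'} ≤ c_{j'}v_{j'}/G² ≤ m̃/G²`.
No definitions; no `sorry`.
-/

namespace Literature.MathematicalPhysics.QuantumLattice.Imbrie2016

/-- Lemma 5.8(b), `k = 3`, three residual levels, in the case where `ν₁` is the level closest
to `z` (`c₁ ≤ c₂`, `c₁ ≤ c₃`).  [cite: ImbrieJSP2016, §4.2.1]  [folklore] -/
theorem domination_three_of_min (v₁ v₂ v₃ ν₁ ν₂ ν₃ z G : ℝ) (hG : 0 < G)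
    (hv₁ : 0 ≤ v₁) (hv₂ : 0 ≤ v₂) (hv₃ : 0 ≤ v₃)
    (hc₁ : G ^ 2 ≤ (ν₁ - z) ^ 2)
    (h12 : (ν₁ - z) ^ 2 ≤ (ν₂ - z) ^ 2) (h13 : (ν₁ - z) ^ 2 ≤ (ν₃ - z) ^ 2) :
    v₁ * v₂ * v₃ * ((ν₂ - ν₁) ^ 2 * (ν₃ - ν₁) ^ 2 * (ν₃ - ν₂) ^ 2)
      ≤ 16 / G ^ 2 * ((ν₁ - z) ^ 2 * v₁ + (ν₂ - z) ^ 2 * v₂ + (ν₃ - z) ^ 2 * v₃)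
          * (((ν₁ - z) ^ 2 * v₁) * ((ν₂ - z) ^ 2 * v₂) * (ν₂ - ν₁) ^ 2
            + ((ν₁ - z) ^ 2 * v₁) * ((ν₃ - z) ^ 2 * v₃) * (ν₃ - ν₁) ^ 2
            + ((ν₂ - z) ^ 2 * v₂) * ((ν₃ - z) ^ 2 * v₃) * (ν₃ - ν₂) ^ 2) := by
  set c₁ := (ν₁ - z) ^ 2 with hc1
  set c₂ := (ν₂ - z) ^ 2 with hc2
  set c₃ := (ν₃ - z) ^ 2 with hc3
  have hG2 : 0 < G ^ 2 := by positivity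
  have hc₁0 : 0 ≤ c₁ := sq_nonneg _
  have hc₂0 : 0 ≤ c₂ := sq_nonneg _
  have hc₃0 : 0 ≤ c₃ := sq_nonneg _
  -- (ν₂-ν₁)² ≤ 4 c₂ and (ν₃-ν₁)² ≤ 4 c₃
  have A : (ν₂ - ν₁) ^ 2 ≤ 4 * c₂ := by
    have h : (ν₂ - ν₁) ^ 2 ≤ 2 * (ν₂ - z) ^ 2 + 2 * (ν₁ - z) ^ 2 := by
      nlinarith [sq_nonneg ((ν₂ - z) + (ν₁ - z))]
    linarith
  have B : (ν₃ - ν₁) ^ 2 ≤ 4 * c₃ := by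
    have h : (ν₃ - ν₁) ^ 2 ≤ 2 * (ν₃ - z) ^ 2 + 2 * (ν₁ - z) ^ 2 := by
      nlinarith [sq_nonneg ((ν₃ - z) + (ν₁ - z))]
    linarith
  -- m̃ ≥ c₁ v₁ ≥ G² v₁
  set M := c₁ * v₁ + c₂ * v₂ + c₃ * v₃ with hM
  have hM0 : 0 ≤ M := by positivity
  have hv₁M : v₁ ≤ M / G ^ 2 := by
    rw [le_div_iff₀ hG2]
    have : v₁ * G ^ 2 ≤ c₁ * v₁ := by nlinarith
    nlinarith [mul_nonneg hc₂0 hv₂, mul_nonneg hc₃0 hv₃]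
  -- the term kept
  set T := (c₂ * v₂) * (c₃ * v₃) * (ν₃ - ν₂) ^ 2 with hT
  have hT0 : 0 ≤ T := by positivity
  have hD0 : 0 ≤ (c₁ * v₁) * (c₂ * v₂) * (ν₂ - ν₁) ^ 2 + (c₁ * v₁) * (c₃ * v₃) * (ν₃ - ν₁) ^ 2 := by
    positivity
  have step1 : v₁ * v₂ * v₃ * ((ν₂ - ν₁) ^ 2 * (ν₃ - ν₁) ^ 2 * (ν₃ - ν₂) ^ 2)
      ≤ v₁ * v₂ * v₃ * ((4 * c₂) * (4 * c₃) * (ν₃ - ν₂) ^ 2) := by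
    apply mul_le_mul_of_nonneg_left _ (by positivity)
    apply mul_le_mul_of_nonneg_right _ (sq_nonneg _)
    exact mul_le_mul A B (sq_nonneg _) (by positivity)
  have step2 : v₁ * v₂ * v₃ * ((4 * c₂) * (4 * c₃) * (ν₃ - ν₂) ^ 2) = 16 * v₁ * T := by
    rw [hT]; ring
  have step3 : 16 * v₁ * T ≤ 16 * (M / G ^ 2) * T := by
    have : v₁ * T ≤ (M / G ^ 2) * T := mul_le_mul_of_nonneg_right hv₁M hT0
    linarith
  have step4 : 16 * (M / G ^ 2) * T
      ≤ 16 / G ^ 2 * M * ((c₁ * v₁) * (c₂ * v₂) * (ν₂ - ν₁) ^ 2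
            + (c₁ * v₁) * (c₃ * v₃) * (ν₃ - ν₁) ^ 2 + T) := by
    have e : 16 * (M / G ^ 2) * T = 16 / G ^ 2 * M * T := by ring
    rw [e]
    apply mul_le_mul_of_nonneg_left _ (by positivity)
    linarith
  calc v₁ * v₂ * v₃ * ((ν₂ - ν₁) ^ 2 * (ν₃ - ν₁) ^ 2 * (ν₃ - ν₂) ^ 2)
      ≤ v₁ * v₂ * v₃ * ((4 * c₂) * (4 * c₃) * (ν₃ - ν₂) ^ 2) := step1
    _ = 16 * v₁ * T := step2
    _ ≤ 16 * (M / G ^ 2) * T := step3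
    _ ≤ 16 / G ^ 2 * M * ((c₁ * v₁) * (c₂ * v₂) * (ν₂ - ν₁) ^ 2
            + (c₁ * v₁) * (c₃ * v₃) * (ν₃ - ν₁) ^ 2 + T) := step4
    _ = _ := by rw [hT, hM]

/-- Lemma 5.8(b), `k = 3`, three residual levels (DENSITY-XY §5.4; the `n = 4` step of Thm 5.7):
`v₁v₂v₃Δ(ν)² ≤ (16/G²)·m̃·D̃₂` whenever every `ν_j` is at distance `≥ G` from `z`.
[cite: ImbrieJSP2016, §4.2.1]  [folklore] -/
theorem domination_three (v₁ v₂ v₃ ν₁ ν₂ ν₃ z G : ℝ) (hG : 0 < G)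
    (hv₁ : 0 ≤ v₁) (hv₂ : 0 ≤ v₂) (hv₃ : 0 ≤ v₃)
    (hc₁ : G ^ 2 ≤ (ν₁ - z) ^ 2) (hc₂ : G ^ 2 ≤ (ν₂ - z) ^ 2) (hc₃ : G ^ 2 ≤ (ν₃ - z) ^ 2) :
    v₁ * v₂ * v₃ * ((ν₂ - ν₁) ^ 2 * (ν₃ - ν₁) ^ 2 * (ν₃ - ν₂) ^ 2)
      ≤ 16 / G ^ 2 * ((ν₁ - z) ^ 2 * v₁ + (ν₂ - z) ^ 2 * v₂ + (ν₃ - z) ^ 2 * v₃)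
          * (((ν₁ - z) ^ 2 * v₁) * ((ν₂ - z) ^ 2 * v₂) * (ν₂ - ν₁) ^ 2
            + ((ν₁ - z) ^ 2 * v₁) * ((ν₃ - z) ^ 2 * v₃) * (ν₃ - ν₁) ^ 2
            + ((ν₂ - z) ^ 2 * v₂) * ((ν₃ - z) ^ 2 * v₃) * (ν₃ - ν₂) ^ 2) := by
  rcases le_total ((ν₁ - z) ^ 2) ((ν₂ - z) ^ 2) with h12 | h21
  · rcases le_total ((ν₁ - z) ^ 2) ((ν₃ - z) ^ 2) with h13 | h31
    · exact domination_three_of_min v₁ v₂ v₃ ν₁ ν₂ ν₃ z G hG hv₁ hv₂ hv₃ hc₁ h12 h13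
    · -- ν₃ is closest: apply the case lemma to (3,1,2)
      have h32 : (ν₃ - z) ^ 2 ≤ (ν₂ - z) ^ 2 := le_trans h31 h12
      have h := domination_three_of_min v₃ v₁ v₂ ν₃ ν₁ ν₂ z G hG hv₃ hv₁ hv₂ hc₃ h31 h32
      calc v₁ * v₂ * v₃ * ((ν₂ - ν₁) ^ 2 * (ν₃ - ν₁) ^ 2 * (ν₃ - ν₂) ^ 2)
          = v₃ * v₁ * v₂ * ((ν₁ - ν₃) ^ 2 * (ν₂ - ν₃) ^ 2 * (ν₂ - ν₁) ^ 2) := by ring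
        _ ≤ _ := h
        _ = _ := by ring
  · rcases le_total ((ν₂ - z) ^ 2) ((ν₃ - z) ^ 2) with h23 | h32
    · -- ν₂ is closest: apply the case lemma to (2,1,3)
      have h := domination_three_of_min v₂ v₁ v₃ ν₂ ν₁ ν₃ z G hG hv₂ hv₁ hv₃ hc₂ h21 h23
      calc v₁ * v₂ * v₃ * ((ν₂ - ν₁) ^ 2 * (ν₃ - ν₁) ^ 2 * (ν₃ - ν₂) ^ 2)
          = v₂ * v₁ * v₃ * ((ν₁ - ν₂) ^ 2 * (ν₃ - ν₂) ^ 2 * (ν₃ - ν₁) ^ 2) := by ring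
        _ ≤ _ := h
        _ = _ := by ring
    · -- ν₃ is closest: (3,1,2) with c₃ ≤ c₂ ≤ c₁
      have h31 : (ν₃ - z) ^ 2 ≤ (ν₁ - z) ^ 2 := le_trans h32 h21
      have h := domination_three_of_min v₃ v₁ v₂ ν₃ ν₁ ν₂ z G hG hv₃ hv₁ hv₂ hc₃ h31 h32
      calc v₁ * v₂ * v₃ * ((ν₂ - ν₁) ^ 2 * (ν₃ - ν₁) ^ 2 * (ν₃ - ν₂) ^ 2)
          = v₃ * v₁ * v₂ * ((ν₁ - ν₃) ^ 2 * (ν₂ - ν₃) ^ 2 * (ν₂ - ν₁) ^ 2) := by ring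
        _ ≤ _ := h
        _ = _ := by ring

end Literature.MathematicalPhysics.QuantumLattice.Imbrie2016
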